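import Summits.ABC.IUTFork.ForkThm110
import HarnessLib

/-!
# The fork at [IUTchIII] Corollary 3.12, XXIIc: what the (Ind1) readings do to the M-branch's estimate

Record-only file (D-0012) of the abc-iut cell's fork skeleton (seat abc-iut-skel); TAKES NO SIDE. Skeleton III
(`ForkThm110`) types, for one curve, the two inputs of Mochizuki's branch — `MultiradialEstimate`
(`−|log(Θ)| ≤ C_Θ·|log(q)|` with the PRINTED `C_Θ`, [IUTchIV] Thm. 1.10) and `Cor312` — and proves
`display_of_cor312`. Skeleton XXII (`ForkInd1`) types the two readings of (Ind1) at Step (v): under the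
SYMMETRY reading (S) the Θ-side gain at `v_ℚ` is the text's `log(q_{v_ℚ})`; under the UNION reading (U) it is
the smaller `m_j ≤ log(q_{v_ℚ})` (strictly smaller when the places of `F_mod` over `v_ℚ` carry different
`ord(q)`, collapsing geometrically when some are good; campaign S: `Thm110MinVariant`, abc-iut-S3 p407418).
This file records, in skeleton III's own currency (the displayed inequality of Thm. 1.10), WHAT IS AT STAKE:

* `EstimateWith ρ` — the multiradial estimate with the printed `q`-term `(1/6)(1 − 12/l²)·log(q)` of the
  bracket scaled by a SURVIVING FRACTION `ρ` (`ρ = 1`: the text = reading (S), `estimateWith_one_iff`;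
  reading (U): `ρ = ` the ratio of the (U)- to the (S)-aggregate of XXII, `≤ 1`, NOT computed here);
* `estimateWith_mono` — smaller `ρ` = weaker estimate;
* `displayWith_of_cor312` — Cor. 3.12 + `EstimateWith ρ` give EXACTLY
  `(ρ/6)(1 − 12/l²)·log(q) ≤ (1 + 12·d_mod/l)(log 𝔡 + log 𝔣) + 10(e*_mod·l + η_prm)`: the `−|log(q)|` of
  Cor. 3.12 cancels against the `−1` of `C_Θ` (Step (viii) p. 30: "`(l+1)/4·{…} − (1/2l)·log(q)`"), so the
  Diophantine content is carried ENTIRELY by the Θ-side `q`-gain — the quantity the (Ind1) readings dispute;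
* `no_bound_at_zero` — at `ρ = 0` (total collapse of the Θ-side gain) `Cor312 ∧ EstimateWith 0` hold with
  `log(q)` ARBITRARILY LARGE: the M-branch then bounds nothing — the same terminus as the SS-branch of the
  fork (`ForkCopies`/`ForkModel`: `IdentifiedCopies → ¬ NontrivialBound`), reached from inside (Ind1);
* `logq_le_of_cor312` — for `ρ > 0` the surviving bound `log(q) ≤ (6/ρ)(1 − 12/l²)⁻¹·[…]`, i.e. the
  printed display with its constant inflated by `1/ρ` (up to the p. 31 coefficient step).

HONEST FRAMING: nothing here says which `ρ` is the right one; `ρ = 1` is what [IUTchIV] prints, `ρ < 1` is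
what the typed nouns deliver for `d_mod > 1` under reading (U) (XXII, S3, abc-iut-c312-d1 STEPV-IND1-NOTE).
[claim: Mochizuki2012, status: disputed] ([IUTchIV] Thm. 1.10 pp. 22–23, Step (v) pp. 27–28, Step (viii)
p. 30) Deliberately NOT here: the value of `ρ` for a given curve (campaign S `Thm110MinVariant`); any judgement.
-/

noncomputable section

namespace Summit.ABC.IUTFork

namespace Thm110Data

variable (X : Thm110Data)

/-- The bracket of the printed `C_Θ` with its `q`-term scaled by the surviving fraction `ρ`:
`{(1 + 12·d_mod/l)(log 𝔡 + log 𝔣) + 10(e*_mod·l + η_prm) − (1/6)(1 − 12/l²)·ρ·log(q)}`.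
[claim: Mochizuki2012, status: disputed] -/
def bracketWith (ρ : ℝ) : ℝ :=
  (1 + 12 * (X.dmod : ℝ) / X.l) * X.logdf + 10 * (X.estar * X.l + X.eta)
    - 1 / 6 * (1 - 12 / ((X.l : ℝ) ^ 2)) * ρ * X.logq

/-- `C_Θ(ρ) := (l+1)/(4·|log(q)|)·bracketWith ρ − 1`. [claim: Mochizuki2012, status: disputed] -/
def CThetaWith (ρ : ℝ) : ℝ := ((X.l : ℝ) + 1) / (4 * X.absLogq) * X.bracketWith ρ - 1

/-- **The multiradial estimate with surviving `q`-gain fraction `ρ`**: `−|log(Θ)| ≤ C_Θ(ρ)·|log(q)|`.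
`ρ = 1` is the printed estimate (reading (S) of (Ind1) at Step (v)); reading (U) supplies some `ρ ≤ 1`
(the ratio `m_j / log(q_{v_ℚ})` aggregated, skeleton XXII / S3 `Thm110MinVariant`). HYPOTHESIS, never
asserted. [claim: Mochizuki2012, status: disputed] -/
@[claim "Mochizuki2012" "disputed"] def EstimateWith (ρ : ℝ) : Prop :=
  X.negLogTheta ≤ X.CThetaWith ρ * X.absLogq

/-- At `ρ = 1` the bracket is the printed one. [folklore] -/
theorem bracketWith_one : X.bracketWith 1 = X.bracket := by
  unfold bracketWith bracket; ring

/-- **`ρ = 1` is the text**: `EstimateWith 1 ↔ MultiradialEstimate`. [folklore] -/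
theorem estimateWith_one_iff : X.EstimateWith 1 ↔ X.MultiradialEstimate := by
  unfold EstimateWith MultiradialEstimate CThetaWith CTheta
  rw [bracketWith_one]

/-- The bracket is antitone in `ρ` (`log(q) > 0`, `1 − 12/l² > 0`). [folklore] -/
theorem bracketWith_antitone {ρ ρ' : ℝ} (h : ρ' ≤ ρ) : X.bracketWith ρ ≤ X.bracketWith ρ' := by
  unfold bracketWith
  have h7 : (7 : ℝ) ≤ X.l := by exact_mod_cast X.seven_le_l
  have hl2 : 0 < 1 - 12 / ((X.l : ℝ) ^ 2) := by
    have : (49 : ℝ) ≤ (X.l : ℝ) ^ 2 := by nlinarith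
    have : 12 / ((X.l : ℝ) ^ 2) ≤ 12 / 49 := div_le_div_of_nonneg_left (by norm_num) (by norm_num) this
    linarith
  have := mul_le_mul_of_nonneg_left h (mul_nonneg (mul_nonneg (by norm_num : (0:ℝ) ≤ 1 / 6) hl2.le)
    X.logq_pos.le)
  nlinarith

/-- **Smaller surviving fraction = weaker estimate**: `EstimateWith ρ → EstimateWith ρ'` for `ρ' ≤ ρ`.
[folklore] -/
theorem estimateWith_mono {ρ ρ' : ℝ} (h : ρ' ≤ ρ) (hρ : X.EstimateWith ρ) : X.EstimateWith ρ' := by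
  unfold EstimateWith CThetaWith at *
  have hq := X.absLogq_pos
  have h7 : (7 : ℝ) ≤ X.l := by exact_mod_cast X.seven_le_l
  have hc : 0 ≤ ((X.l : ℝ) + 1) / (4 * X.absLogq) := by positivity
  have hb := mul_le_mul_of_nonneg_left (X.bracketWith_antitone h) hc
  have := mul_le_mul_of_nonneg_right (sub_le_sub_right hb 1) hq.le
  exact hρ.trans this

/-- **What Cor. 3.12 + the estimate with fraction `ρ` give, exactly**: the bracket is nonnegative, i.e.
`(ρ/6)(1 − 12/l²)·log(q) ≤ (1 + 12·d_mod/l)(log 𝔡 + log 𝔣) + 10(e*_mod·l + η_prm)` — the `−|log(q)|` of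
Cor. 3.12 cancels the `−1` of `C_Θ`; all Diophantine content sits in the Θ-side `q`-gain `ρ`.
[claim: Mochizuki2012, status: disputed] -/
theorem displayWith_of_cor312 {ρ : ℝ} (h1 : X.EstimateWith ρ) (h2 : X.Cor312) :
    1 / 6 * (1 - 12 / ((X.l : ℝ) ^ 2)) * ρ * X.logq ≤
      (1 + 12 * (X.dmod : ℝ) / X.l) * X.logdf + 10 * (X.estar * X.l + X.eta) := by
  unfold EstimateWith CThetaWith at h1
  unfold Cor312 at h2
  have hq := X.absLogq_pos
  have h7 : (7 : ℝ) ≤ X.l := by exact_mod_cast X.seven_le_l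
  have hc : 0 < ((X.l : ℝ) + 1) / (4 * X.absLogq) := by positivity
  have h : -X.absLogq ≤ (((X.l : ℝ) + 1) / (4 * X.absLogq) * X.bracketWith ρ - 1) * X.absLogq :=
    h2.trans h1
  have h0 : 0 ≤ ((X.l : ℝ) + 1) / (4 * X.absLogq) * X.bracketWith ρ * X.absLogq := by nlinarith
  have hb : 0 ≤ X.bracketWith ρ := by
    by_contra hb
    rw [not_le] at hb
    have : ((X.l : ℝ) + 1) / (4 * X.absLogq) * X.bracketWith ρ * X.absLogq < 0 :=
      mul_neg_of_neg_of_pos (mul_neg_of_pos_of_neg hc hb) hq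
    linarith
  unfold bracketWith at hb
  linarith

/-- **For `ρ > 0` a bound survives**, with the constant inflated by `1/ρ`:
`log(q) ≤ (6/ρ)·(1 − 12/l²)⁻¹·[(1 + 12·d_mod/l)(log 𝔡 + log 𝔣) + 10(e*_mod·l + η_prm)]`. [folklore] -/
theorem logq_le_of_cor312 {ρ : ℝ} (hρ : 0 < ρ) (h1 : X.EstimateWith ρ) (h2 : X.Cor312) :
    X.logq ≤ 6 / ρ * (1 - 12 / ((X.l : ℝ) ^ 2))⁻¹ *
      ((1 + 12 * (X.dmod : ℝ) / X.l) * X.logdf + 10 * (X.estar * X.l + X.eta)) := by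
  have h := X.displayWith_of_cor312 h1 h2
  have h7 : (7 : ℝ) ≤ X.l := by exact_mod_cast X.seven_le_l
  have hl2 : 0 < 1 - 12 / ((X.l : ℝ) ^ 2) := by
    have : (49 : ℝ) ≤ (X.l : ℝ) ^ 2 := by nlinarith
    have : 12 / ((X.l : ℝ) ^ 2) ≤ 12 / 49 := div_le_div_of_nonneg_left (by norm_num) (by norm_num) this
    linarith
  set A := (1 + 12 * (X.dmod : ℝ) / X.l) * X.logdf + 10 * (X.estar * X.l + X.eta) with hA
  have hk : 0 < 1 / 6 * (1 - 12 / ((X.l : ℝ) ^ 2)) * ρ := by positivity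
  have : X.logq ≤ A / (1 / 6 * (1 - 12 / ((X.l : ℝ) ^ 2)) * ρ) := by
    rw [le_div_iff₀ hk]; linarith
  refine this.trans (le_of_eq ?_)
  field_simp

/-- **At `ρ = 0` nothing is bounded**: for every `B` there are Thm-1.10 data with `log(q) > B` satisfying
BOTH `Cor312` and `EstimateWith 0` (take `−|log(Θ)| := −|log(q)|`, no log-different, `l = 7`, `d_mod = 1`,
`e* = η = 0`). The M-branch with a totally collapsed Θ-side gain reaches the SS-branch's terminus ("no
bound"). [folklore] -/
theorem no_bound_at_zero (B : ℝ) : ∃ X : Thm110Data, B < X.logq ∧ X.Cor312 ∧ X.EstimateWith 0 := by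
  have hq1 : 0 < max B 0 + 1 := by positivity
  -- fields: l, 7 ≤ l, d_mod, 1 ≤ d_mod, e*, 0 ≤ e*, η, 0 ≤ η, log 𝔡𝔣, 0 ≤ log 𝔡𝔣, log q, 0 < log q, −|log Θ|
  let X : Thm110Data := ⟨7, le_rfl, 1, le_rfl, 0, le_rfl, 0, le_rfl, 0, le_rfl, max B 0 + 1, hq1,
    -((max B 0 + 1) / (2 * ((7 : ℕ) : ℝ)))⟩
  refine ⟨X, ?_, le_rfl, ?_⟩
  · show B < max B 0 + 1
    have := le_max_left B 0; linarith
  · unfold EstimateWith CThetaWith bracketWith absLogq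
    show -((max B 0 + 1) / (2 * ((7 : ℕ) : ℝ))) ≤
      ((((7 : ℕ) : ℝ) + 1) / (4 * ((max B 0 + 1) / (2 * ((7 : ℕ) : ℝ)))) *
        ((1 + 12 * ((1 : ℕ) : ℝ) / ((7 : ℕ) : ℝ)) * 0 + 10 * (0 * ((7 : ℕ) : ℝ) + 0)
          - 1 / 6 * (1 - 12 / (((7 : ℕ) : ℝ) ^ 2)) * 0 * (max B 0 + 1)) - 1) *
        ((max B 0 + 1) / (2 * ((7 : ℕ) : ℝ)))
    simp only [Nat.cast_ofNat, Nat.cast_one]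
    have hq : 0 < (max B 0 + 1) / (2 * 7) := by positivity
    nlinarith

/-- **The stakes, side by side.** With surviving fraction `ρ`: at `ρ = 1` the printed chain
(`display_of_cor312`); for `ρ > 0` a bound with constant `∝ 1/ρ`; at `ρ = 0` none. Which `ρ` the
(Ind1)-indeterminacy leaves for `d_mod > 1` is the question typed in XXII. [claim: Mochizuki2012, status: disputed] -/
theorem stakes :
    (∀ X : Thm110Data, X.EstimateWith 1 → X.Cor312 → X.Display) ∧
      (∀ X : Thm110Data, ∀ ρ : ℝ, 0 < ρ → X.EstimateWith ρ → X.Cor312 →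
        X.logq ≤ 6 / ρ * (1 - 12 / ((X.l : ℝ) ^ 2))⁻¹ *
          ((1 + 12 * (X.dmod : ℝ) / X.l) * X.logdf + 10 * (X.estar * X.l + X.eta))) ∧
      (∀ B : ℝ, ∃ X : Thm110Data, B < X.logq ∧ X.Cor312 ∧ X.EstimateWith 0) :=
  ⟨fun X h1 h2 => X.display_of_cor312 ((X.estimateWith_one_iff).1 h1) h2,
    fun X _ hρ h1 h2 => X.logq_le_of_cor312 hρ h1 h2, no_bound_at_zero⟩

end Thm110Data

end Summit.ABC.IUTFork

end
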